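import Mathlib
import HarnessLib
import Summits.MatrixMultiplication.MatrixMultiplication.Theses.AutomaticSTPPDesigns
import Literature.Computability.AutomaticStructures.AutomaticBlock
import Literature.Computability.AlgebraicComplexity.GroupTheoreticMatMulThmBProofs
import Summits.MatrixMultiplication.MatrixMultiplication.Theorems.AutomaticSTPPDesignsAutomaticPackingThesisStubChartSTPP
import Summits.MatrixMultiplication.MatrixMultiplication.Theorems.AutomaticSTPPDesignsAutomaticPackingThesisStubChartPower
import Summits.MatrixMultiplication.MatrixMultiplication.Theorems.AutomaticSTPPDesignsAutomaticPackingThesisStubConcatSTPP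
import Summits.MatrixMultiplication.MatrixMultiplication.Theorems.AutomaticSTPPDesignsBlockTensorTransfer
import Summits.MatrixMultiplication.MatrixMultiplication.Theorems.AutomaticSTPPDesignsAutomaticPackingThesisStubPowFamily
import Summits.MatrixMultiplication.MatrixMultiplication.Theorems.AutomaticSTPPDesignsAutomaticPackingThesisStubTypeCount
import Summits.MatrixMultiplication.MatrixMultiplication.Theorems.AutomaticSTPPDesignsAutomaticPackingThesisStubExpBeatsPoly
import Summits.MatrixMultiplication.MatrixMultiplication.Theorems.AutomaticSTPPDesignsAutomaticPackingThesisStubTripleConcat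
import Summits.MatrixMultiplication.MatrixMultiplication.Theorems.AutomaticSTPPDesignsAutomaticPackingThesisUniformNormalForm
import Summits.MatrixMultiplication.MatrixMultiplication.Theorems.AutomaticSTPPDesignsAutomaticPackingThesisUniformWitnessSize
import Summits.MatrixMultiplication.MatrixMultiplication.Theorems.AutomaticSTPPDesignsAutomaticPackingThesisCyclicCalibration094
import Summits.MatrixMultiplication.MatrixMultiplication.Theorems.AutomaticSTPPDesignsAutomaticPackingThesisPrimeUniform
import Summits.MatrixMultiplication.MatrixMultiplication.Theorems.AutomaticSTPPDesignsAutomaticPackingThesisCyclicCalibration080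
import Summits.MatrixMultiplication.MatrixMultiplication.Theses.GroupTheoreticSTPP
import Summits.MatrixMultiplication.MatrixMultiplication.Theorems.AutomaticSTPPDesignsAutomaticPackingThesisCruxGivesCThesis
import Summits.MatrixMultiplication.MatrixMultiplication.Theorems.AutomaticSTPPDesignsAutomaticPackingThesisRankNormalForm
import Summits.MatrixMultiplication.MatrixMultiplication.Theorems.AutomaticSTPPDesignsAutomaticPackingThesisTwoFamiliesBridge
import Summits.MatrixMultiplication.MatrixMultiplication.Theorems.AutomaticSTPPDesignsAutomaticPackingThesisStubPricing

/-!
# Crux `AutomaticPackingThesis` (stmt-MatrixMultiplication-7356) — line `Sketch`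

Skeleton of the line (lead prover's reshaping of the ideators' `Sketch.lean`): carry-robust
charts (crux idea `carry-robust-charts`) feed the merit amplifier / normal form (crux idea
`cyclic-ratio-normal-form`) through the route's calibration lemma `BlockTensorTransfer`.

* `stub_blockTensorTransfer` — the route support item `BlockTensorTransfer` (stmt-7361).
* `stub_chartSTPP` — CKSU 2005 Thm 37 (chart ⇒ STPP) read WITH CARRIES in the cyclic group
  `ℤ/p^k`: a chart of digit sets whose symbol triples have the TPP in `ℤ/p`, and an index code
  `U ⊆ Γ^k` every non-constant triple of which has a coordinate where the six-term STPP digit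
  combination avoids `[-2, 2]` mod `p` (a carry-robust witness), gives an STPP family of digit
  boxes in `ℤ/p^k` (carries of the STPP equation are bounded by `2`).
* `stub_chartPower` — concatenation powers `U^(m) ⊆ Γ^(m k)` of a carry-robust code are
  carry-robust codes, and the packing functional is multiplicative.
* (`stub_chartCapacity` — carry-robust chart capacity reaches the packing bound — was the
  mechanism stub of cycles 1–3; DE-REGISTERED in cycle 4 (lead c3): conjecture-grade, strictly
  stronger than `stub_cyclicBeat`, and every fixed base `p` is capped above `2/3` by BCCGNSU 2017
  Thm A, so it is not worker-sized; its content survives as the hypothesis `h4` of the proved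
  implication `cyclicBeat_of_charts`.)
* `stub_concatSTPP` — (reshape, cycle 1) STPP families in `ℤ/p^K` and `ℤ/p^K'` concatenate
  digit-wise into an STPP family in `ℤ/p^(K+K')` (crux idea `concatenation-monoid-normal-form`):
  prime-power cyclic designs form a graded monoid, so ONE finite design beating its host powers up.
* `stub_cyclicBeat` — (reshape, cycle 1) THE LOAD-BEARING OPEN STUB in normal form, and since
  cycle 4 the ONLY open stub: for every `τ > 2/3` some finite STPP design in some `ℤ/p^K` beats its
  host, `p^K < Σ_i x_i^τ`. PROVED EQUIVALENT to the crux (`cyclicBeat_of_crux` below; tree: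
  `automaticPackingThesis_iff_cyclicBeat`, p122700); holds at every `τ ≥ 4/5` (stub 15, cycle 4) —
  the cyclic-host case of the CKSU 2005 packing-bound construction problem (ω = 2 strength).
* `cyclicBeat_of_charts` — real proof: stubs 2, 3 and a chart-capacity hypothesis ⇒
  `stub_cyclicBeat`'s statement.
* `stub_beatPricesOmega` — (cycle 5, lead c4) PRICING of the open stub: a cyclic STPP design
  beating its host at exponent `τ` proves `ω(ℂ) < 3τ` (CKSU Thm 5.5 at one exponent; CLOSED,
  p151449); `omega_eq_two_of_cyclicBeat`: the open stub alone gives `ω(ℂ) = 2`.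
* `AutomaticPackingThesis_of` — the composition (real proof): a finite witness at `τ = (2+ε)/3`
  with ratio `r > 1` ⇒ concatenation powers with ratio `r^m > 6` (`concatPower`, from stub 5) ⇒ a
  finite cyclic STPP design with `Σ x^τ > 3·2·N`, `N = p^(Km)` ⇒ (`BlockTensorTransfer`, base `2`)
  a regular all-scales family beating `2^k` at exponent `τ` infinitely often ⇒ the crux, `p = 2`.
-/

set_option linter.dupNamespace false

namespace Summit.MatrixMultiplication.MatrixMultiplication.Cruxes.AutomaticPackingThesis.Sketch

open Finset Literature.Combinatorics.Additive Literature.Computability.AlgebraicComplexity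
  Literature.Computability.AutomaticStructures
open Summit.MatrixMultiplication.MatrixMultiplication.Theses.AutomaticSTPPDesigns

/-- Stub 1: the route's calibration lemma `BlockTensorTransfer` (support item
stmt-MatrixMultiplication-7361): every finite cyclic STPP design with `Σ x_i^τ > 3pN` gives,
for the base `p`, a regular all-scales STPP family beating `p^k` at exponent `τ` infinitely
often. -/
theorem stub_blockTensorTransfer : BlockTensorTransfer :=
  -- CLOSED upstream (route item stmt-7361): Theorems/AutomaticSTPPDesignsBlockTensorTransfer.lean
  Summit.MatrixMultiplication.MatrixMultiplication.Theorems.blockTensorTransfer_proof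

/-- Stub 2 (carry-robust chart theorem, one scale): CKSU 2005 Thm 37 with carries. Digit sets
`A B C : Γ → Finset (Fin p)` whose symbol triples have the TPP in `ℤ/p`, and a code
`U ⊆ Γ^k` in which every non-constant ordered triple `(u, v, w)` has a coordinate `j` where the
STPP digit combination `(s' - s) + (t' - t) + (c' - c)` (`s ∈ A (w j)`, `s' ∈ A (u j)`,
`t ∈ B (u j)`, `t' ∈ B (v j)`, `c ∈ C (v j)`, `c' ∈ C (w j)`, the index pattern of the one-clause
STPP form) stays off `[-2, 2]` modulo `p`, give an STPP family of digit boxes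
`∏_j A (u j)` (read in base `p`, least significant digit first) in `ℤ/p^k`. -/
theorem stub_chartSTPP (p k : ℕ) (hp : 2 ≤ p) (Γ : Type) [DecidableEq Γ]
    (A B C : Γ → Finset (Fin p))
    (hT : ∀ x : Γ, AddTripleProductProperty
      ((A x).image fun d : Fin p => ((d : ℕ) : ZMod p))
      ((B x).image fun d : Fin p => ((d : ℕ) : ZMod p))
      ((C x).image fun d : Fin p => ((d : ℕ) : ZMod p)))
    (U : Finset (Fin k → Γ))
    (hU : ∀ u ∈ U, ∀ v ∈ U, ∀ w ∈ U, ¬ (u = v ∧ v = w) → ∃ j : Fin k,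
      ∀ s ∈ A (w j), ∀ s' ∈ A (u j), ∀ t ∈ B (u j), ∀ t' ∈ B (v j), ∀ c ∈ C (v j),
        ∀ c' ∈ C (w j), ∀ e : ℤ, |e| ≤ 2 →
          (((((s' : ℕ) : ℤ) - (s : ℕ)) + (((t' : ℕ) : ℤ) - (t : ℕ)) + (((c' : ℕ) : ℤ) - (c : ℕ))
            + e : ℤ) : ZMod p) ≠ 0) :
    AddSimultaneousTPP
      (fun u : U => (Fintype.piFinset fun j => A (u.1 j)).image
        fun a : Fin k → Fin p => (digitValue a : ZMod (p ^ k)))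
      (fun u : U => (Fintype.piFinset fun j => B (u.1 j)).image
        fun a : Fin k → Fin p => (digitValue a : ZMod (p ^ k)))
      (fun u : U => (Fintype.piFinset fun j => C (u.1 j)).image
        fun a : Fin k → Fin p => (digitValue a : ZMod (p ^ k))) :=
  -- CLOSED: landed as `--supports` (p102454), Theorems/AutomaticSTPPDesignsAutomaticPackingThesisStubChartSTPP.lean
  Summit.MatrixMultiplication.MatrixMultiplication.Theorems.AutomaticPackingThesis.stub_chartSTPP
    p k hp Γ A B C hT U hU

/-- Stub 3 (powers of a carry-robust code): if every non-constant triple of `U ⊆ Γ^k` has a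
carry-robust witness coordinate, then so does every non-constant triple of the concatenation
power `U^(m) ⊆ Γ^(m k)` (words whose `m` consecutive blocks of length `k`, block `t` at the
positions `finProdFinEquiv (t, j) = j + k t`, lie in `U`), and the packing functional is
multiplicative: `Σ_{w ∈ U^(m)} (Π_j m(w_j))^τ = (Σ_{u ∈ U} (Π_j m(u_j))^τ)^m` with
`m(x) = |A x| |B x| |C x|`. -/
theorem stub_chartPower (p k m : ℕ) (Γ : Type) [Fintype Γ] [DecidableEq Γ]
    (A B C : Γ → Finset (Fin p)) (U : Finset (Fin k → Γ))
    (hU : ∀ u ∈ U, ∀ v ∈ U, ∀ w ∈ U, ¬ (u = v ∧ v = w) → ∃ j : Fin k,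
      ∀ s ∈ A (w j), ∀ s' ∈ A (u j), ∀ t ∈ B (u j), ∀ t' ∈ B (v j), ∀ c ∈ C (v j),
        ∀ c' ∈ C (w j), ∀ e : ℤ, |e| ≤ 2 →
          (((((s' : ℕ) : ℤ) - (s : ℕ)) + (((t' : ℕ) : ℤ) - (t : ℕ)) + (((c' : ℕ) : ℤ) - (c : ℕ))
            + e : ℤ) : ZMod p) ≠ 0)
    (Um : Finset (Fin (m * k) → Γ))
    (hUm : ∀ w, w ∈ Um ↔ ∀ t : Fin m, (fun j : Fin k => w (finProdFinEquiv (t, j))) ∈ U)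
    (τ : ℝ) :
    (∀ u ∈ Um, ∀ v ∈ Um, ∀ w ∈ Um, ¬ (u = v ∧ v = w) → ∃ j : Fin (m * k),
      ∀ s ∈ A (w j), ∀ s' ∈ A (u j), ∀ t ∈ B (u j), ∀ t' ∈ B (v j), ∀ c ∈ C (v j),
        ∀ c' ∈ C (w j), ∀ e : ℤ, |e| ≤ 2 →
          (((((s' : ℕ) : ℤ) - (s : ℕ)) + (((t' : ℕ) : ℤ) - (t : ℕ)) + (((c' : ℕ) : ℤ) - (c : ℕ))
            + e : ℤ) : ZMod p) ≠ 0) ∧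
    ∑ w ∈ Um, ((∏ j, ((A (w j)).card * (B (w j)).card * (C (w j)).card) : ℕ) : ℝ) ^ τ =
      (∑ u ∈ U, ((∏ j, ((A (u j)).card * (B (u j)).card * (C (u j)).card) : ℕ) : ℝ) ^ τ) ^ m :=
  -- CLOSED: landed as `--supports` (p103858), Theorems/AutomaticSTPPDesignsAutomaticPackingThesisStubChartPower.lean
  Summit.MatrixMultiplication.MatrixMultiplication.Theorems.AutomaticPackingThesis.stub_chartPower
    p k m Γ A B C U hU Um hUm τ

/-! ### Reshape (cycle 1): the concatenation monoid and the normal-form stub -/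

/-- Stub 5 (concatenation of STPP families in a cyclic `p`-tower; crux idea
`concatenation-monoid-normal-form`, lemma `ConcatSTPP`): if `(A, B, C)` is an STPP family in
`ℤ/p^K` and `(A', B', C')` one in `ℤ/p^K'`, the product-indexed family of concatenated blocks
`{x.val + p^K · y.val : x ∈ A i, y ∈ A' i'}` read in `ℤ/p^(K+K')` is an STPP family (reduce the
relation mod `p^K`: the low family forces equal low indices and elements, the low part then
vanishes as an integer, and the quotient by `p^K` is the high relation). -/
theorem stub_concatSTPP (p K K' : ℕ) (hp : 0 < p) (ι ι' : Type)
    (A B C : ι → Finset (ZMod (p ^ K))) (A' B' C' : ι' → Finset (ZMod (p ^ K')))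
    (h : AddSimultaneousTPP A B C) (h' : AddSimultaneousTPP A' B' C') :
    AddSimultaneousTPP
      (fun i : ι × ι' => (A i.1 ×ˢ A' i.2).image
        fun x => ((x.1.val + p ^ K * x.2.val : ℕ) : ZMod (p ^ (K + K'))))
      (fun i : ι × ι' => (B i.1 ×ˢ B' i.2).image
        fun x => ((x.1.val + p ^ K * x.2.val : ℕ) : ZMod (p ^ (K + K'))))
      (fun i : ι × ι' => (C i.1 ×ˢ C' i.2).image
        fun x => ((x.1.val + p ^ K * x.2.val : ℕ) : ZMod (p ^ (K + K')))) :=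
  -- CLOSED: landed as `--supports` (p106067), Theorems/AutomaticSTPPDesignsAutomaticPackingThesisStubConcatSTPP.lean
  Summit.MatrixMultiplication.MatrixMultiplication.Theorems.AutomaticPackingThesis.stub_concatSTPP
    p K K' hp ι ι' A B C A' B' C' h h'

/-- Stub 6 (THE LOAD-BEARING OPEN STUB, normal form `CyclicTowerPacking` pointwise in `τ`): for
every `τ > 2/3` some finite STPP design in some cyclic `p`-group `ℤ/p^K` beats its host at
exponent `τ`. Implied by `stub_chartCapacity` (`cyclicBeat_of_charts`); conjecture-grade. -/
theorem stub_cyclicBeat (τ : ℝ) (hτ : 2 / 3 < τ) :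
    ∃ (p K n : ℕ) (_ : 2 ≤ p) (A B C : Fin n → Finset (ZMod (p ^ K))),
      IsSTPP A B C ∧ (p : ℝ) ^ K < ∑ i, (((A i).card * (B i).card * (C i).card : ℕ) : ℝ) ^ τ := by
  sorry

/-- The concatenation map `(x, y) ↦ x.val + p^K · y.val` from `ℤ/p^K × ℤ/p^K'` to `ℤ/p^(K+K')`
is injective (`p ≠ 0`): block sizes multiply under concatenation. [folklore] -/
theorem concatMap_injective (p K K' : ℕ) (hp : 0 < p) :
    Function.Injective fun x : ZMod (p ^ K) × ZMod (p ^ K') =>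
      ((x.1.val + p ^ K * x.2.val : ℕ) : ZMod (p ^ (K + K'))) := by
  haveI : NeZero (p ^ K) := ⟨pow_ne_zero _ hp.ne'⟩
  haveI : NeZero (p ^ K') := ⟨pow_ne_zero _ hp.ne'⟩
  rintro ⟨x₁, x₂⟩ ⟨y₁, y₂⟩ h
  have hx : x₁.val + p ^ K * x₂.val < p ^ (K + K') := by
    have h1 := x₁.val_lt
    have h2 := x₂.val_lt
    calc x₁.val + p ^ K * x₂.val < p ^ K + p ^ K * x₂.val := by omega
      _ = p ^ K * (x₂.val + 1) := by ring
      _ ≤ p ^ K * p ^ K' := Nat.mul_le_mul_left _ h2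
      _ = p ^ (K + K') := (pow_add _ _ _).symm
  have hy : y₁.val + p ^ K * y₂.val < p ^ (K + K') := by
    have h1 := y₁.val_lt
    have h2 := y₂.val_lt
    calc y₁.val + p ^ K * y₂.val < p ^ K + p ^ K * y₂.val := by omega
      _ = p ^ K * (y₂.val + 1) := by ring
      _ ≤ p ^ K * p ^ K' := Nat.mul_le_mul_left _ h2
      _ = p ^ (K + K') := (pow_add _ _ _).symm
  have h' := congrArg ZMod.val h
  simp only [ZMod.val_natCast_of_lt hx, ZMod.val_natCast_of_lt hy] at h'
  have hpK : 0 < p ^ K := pos_iff_ne_zero.2 (NeZero.ne _)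
  have h1 : x₁.val = y₁.val := by
    have := congrArg (· % p ^ K) h'
    simpa [Nat.add_mul_mod_self_left, Nat.mod_eq_of_lt x₁.val_lt, Nat.mod_eq_of_lt y₁.val_lt]
      using this
  have h2 : x₂.val = y₂.val := by
    have := congrArg (· / p ^ K) h'
    simpa [Nat.add_mul_div_left _ _ hpK, Nat.div_eq_of_lt x₁.val_lt, Nat.div_eq_of_lt y₁.val_lt]
      using this
  exact Prod.ext (ZMod.val_injective _ h1) (ZMod.val_injective _ h2)

/-- **Concatenation powers.** From stub 5: an STPP design in `ℤ/p^K` (indexed by `Fin n`) has,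
for every `m`, an `m`-th concatenation power — an STPP design in `ℤ/p^(K m)` whose packing sum at
any exponent `τ` is the `m`-th power of the original one. -/
theorem concatPower
    (h5 : ∀ (p K K' : ℕ), 0 < p → ∀ (ι ι' : Type)
      (A B C : ι → Finset (ZMod (p ^ K))) (A' B' C' : ι' → Finset (ZMod (p ^ K'))),
      AddSimultaneousTPP A B C → AddSimultaneousTPP A' B' C' →
      AddSimultaneousTPP
        (fun i : ι × ι' => (A i.1 ×ˢ A' i.2).image
          fun x => ((x.1.val + p ^ K * x.2.val : ℕ) : ZMod (p ^ (K + K'))))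
        (fun i : ι × ι' => (B i.1 ×ˢ B' i.2).image
          fun x => ((x.1.val + p ^ K * x.2.val : ℕ) : ZMod (p ^ (K + K'))))
        (fun i : ι × ι' => (C i.1 ×ˢ C' i.2).image
          fun x => ((x.1.val + p ^ K * x.2.val : ℕ) : ZMod (p ^ (K + K')))))
    (p K : ℕ) (hp : 0 < p) (n : ℕ) (A B C : Fin n → Finset (ZMod (p ^ K))) (hS : IsSTPP A B C)
    (τ : ℝ) :
    ∀ m : ℕ, ∃ (nm : ℕ) (Am Bm Cm : Fin nm → Finset (ZMod (p ^ (K * m)))), IsSTPP Am Bm Cm ∧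
      ∑ i, (((Am i).card * (Bm i).card * (Cm i).card : ℕ) : ℝ) ^ τ =
        (∑ i, (((A i).card * (B i).card * (C i).card : ℕ) : ℝ) ^ τ) ^ m := by
  intro m
  induction m with
  | zero =>
    refine ⟨1, fun _ => {0}, fun _ => {0}, fun _ => {0}, ?_, ?_⟩
    · intro i j k s hs s' hs' t ht t' ht' u hu u' hu' _
      simp only [Finset.mem_singleton] at hs hs' ht ht' hu hu'
      exact ⟨Subsingleton.elim _ _, Subsingleton.elim _ _, by rw [hs, hs'], by rw [ht, ht'],
        by rw [hu, hu']⟩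
    · rw [pow_zero, Fin.sum_univ_one, Finset.card_singleton]
      simp only [Nat.cast_one, mul_one, Real.one_rpow]
  | succ m ih =>
    obtain ⟨nm, Am, Bm, Cm, hSm, hsum⟩ := ih
    -- concatenate the `m`-th power (low digits) with the design itself (high digits)
    have hcat := h5 p (K * m) K hp (Fin nm) (Fin n) Am Bm Cm A B C
      ((isSTPP_iff_addSimultaneousTPP _ _ _).1 hSm) ((isSTPP_iff_addSimultaneousTPP _ _ _).1 hS)
    set e : Fin (nm * n) ≃ Fin nm × Fin n := finProdFinEquiv.symm with he
    set A' : Fin nm × Fin n → Finset (ZMod (p ^ (K * m + K))) := fun i =>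
      (Am i.1 ×ˢ A i.2).image fun x => ((x.1.val + p ^ (K * m) * x.2.val : ℕ) : ZMod (p ^ (K * m + K)))
      with hA'
    set B' : Fin nm × Fin n → Finset (ZMod (p ^ (K * m + K))) := fun i =>
      (Bm i.1 ×ˢ B i.2).image fun x => ((x.1.val + p ^ (K * m) * x.2.val : ℕ) : ZMod (p ^ (K * m + K)))
      with hB'
    set C' : Fin nm × Fin n → Finset (ZMod (p ^ (K * m + K))) := fun i =>
      (Cm i.1 ×ˢ C i.2).image fun x => ((x.1.val + p ^ (K * m) * x.2.val : ℕ) : ZMod (p ^ (K * m + K)))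
      with hC'
    have hcat' : IsSTPP (A' ∘ e) (B' ∘ e) (C' ∘ e) :=
      (isSTPP_iff_addSimultaneousTPP _ _ _).2 (hcat.comp e.injective)
    refine ⟨nm * n, A' ∘ e, B' ∘ e, C' ∘ e, hcat', ?_⟩
    -- block sizes multiply, so the packing sum is the product of the two packing sums
    have hcard : ∀ (S : Finset (ZMod (p ^ (K * m)))) (S' : Finset (ZMod (p ^ K))),
        ((S ×ˢ S').image fun x => ((x.1.val + p ^ (K * m) * x.2.val : ℕ) :
          ZMod (p ^ (K * m + K)))).card = S.card * S'.card := by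
      intro S S'
      rw [Finset.card_image_of_injective _ (concatMap_injective p (K * m) K hp), Finset.card_product]
    have hterm : ∀ i : Fin nm × Fin n,
        (((A' i).card * (B' i).card * (C' i).card : ℕ) : ℝ) ^ τ =
          (((Am i.1).card * (Bm i.1).card * (Cm i.1).card : ℕ) : ℝ) ^ τ *
            (((A i.2).card * (B i.2).card * (C i.2).card : ℕ) : ℝ) ^ τ := by
      intro i
      rw [← Real.mul_rpow (Nat.cast_nonneg _) (Nat.cast_nonneg _)]
      congr 1
      simp only [hA', hB', hC', hcard]
      push_cast
      ring
    simp only [Function.comp_apply]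
    rw [e.sum_comp (fun i => (((A' i).card * (B' i).card * (C' i).card : ℕ) : ℝ) ^ τ),
      Fintype.sum_prod_type]
    simp only [hterm]
    rw [← Finset.sum_mul_sum, hsum, pow_succ]

/-- **Charts give finite witnesses.** Stubs 2, 3, 4 imply the statement of stub 6: a capacity
witness `(p, Γ, A, B, C, U ⊆ Γ^k)` with ratio `r = Σ_u x_u^τ / p^k > 1` has powers `U^(m)` with
ratio `r^m` (stub 3), which are STPP families of digit boxes in the cyclic group `ℤ/p^(mk)`
(stub 2); reindexed along `Fin n ≃ U^(m)` this is a finite design beating `p^(mk)`. -/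
theorem cyclicBeat_of_charts
    (h2 : ∀ (p k : ℕ), 2 ≤ p → ∀ (Γ : Type) [DecidableEq Γ] (A B C : Γ → Finset (Fin p)),
      (∀ x : Γ, AddTripleProductProperty
        ((A x).image fun d : Fin p => ((d : ℕ) : ZMod p))
        ((B x).image fun d : Fin p => ((d : ℕ) : ZMod p))
        ((C x).image fun d : Fin p => ((d : ℕ) : ZMod p))) →
      ∀ U : Finset (Fin k → Γ),
      (∀ u ∈ U, ∀ v ∈ U, ∀ w ∈ U, ¬ (u = v ∧ v = w) → ∃ j : Fin k,
        ∀ s ∈ A (w j), ∀ s' ∈ A (u j), ∀ t ∈ B (u j), ∀ t' ∈ B (v j), ∀ c ∈ C (v j),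
          ∀ c' ∈ C (w j), ∀ e : ℤ, |e| ≤ 2 →
            (((((s' : ℕ) : ℤ) - (s : ℕ)) + (((t' : ℕ) : ℤ) - (t : ℕ)) + (((c' : ℕ) : ℤ) - (c : ℕ))
              + e : ℤ) : ZMod p) ≠ 0) →
      AddSimultaneousTPP
        (fun u : U => (Fintype.piFinset fun j => A (u.1 j)).image
          fun a : Fin k → Fin p => (digitValue a : ZMod (p ^ k)))
        (fun u : U => (Fintype.piFinset fun j => B (u.1 j)).image
          fun a : Fin k → Fin p => (digitValue a : ZMod (p ^ k)))
        (fun u : U => (Fintype.piFinset fun j => C (u.1 j)).image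
          fun a : Fin k → Fin p => (digitValue a : ZMod (p ^ k))))
    (h3 : ∀ (p k m : ℕ) (Γ : Type) [Fintype Γ] [DecidableEq Γ]
      (A B C : Γ → Finset (Fin p)) (U : Finset (Fin k → Γ)),
      (∀ u ∈ U, ∀ v ∈ U, ∀ w ∈ U, ¬ (u = v ∧ v = w) → ∃ j : Fin k,
        ∀ s ∈ A (w j), ∀ s' ∈ A (u j), ∀ t ∈ B (u j), ∀ t' ∈ B (v j), ∀ c ∈ C (v j),
          ∀ c' ∈ C (w j), ∀ e : ℤ, |e| ≤ 2 →
            (((((s' : ℕ) : ℤ) - (s : ℕ)) + (((t' : ℕ) : ℤ) - (t : ℕ)) + (((c' : ℕ) : ℤ) - (c : ℕ))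
              + e : ℤ) : ZMod p) ≠ 0) →
      ∀ (Um : Finset (Fin (m * k) → Γ)),
      (∀ w, w ∈ Um ↔ ∀ t : Fin m, (fun j : Fin k => w (finProdFinEquiv (t, j))) ∈ U) →
      ∀ τ : ℝ,
      (∀ u ∈ Um, ∀ v ∈ Um, ∀ w ∈ Um, ¬ (u = v ∧ v = w) → ∃ j : Fin (m * k),
        ∀ s ∈ A (w j), ∀ s' ∈ A (u j), ∀ t ∈ B (u j), ∀ t' ∈ B (v j), ∀ c ∈ C (v j),
          ∀ c' ∈ C (w j), ∀ e : ℤ, |e| ≤ 2 →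
            (((((s' : ℕ) : ℤ) - (s : ℕ)) + (((t' : ℕ) : ℤ) - (t : ℕ)) + (((c' : ℕ) : ℤ) - (c : ℕ))
              + e : ℤ) : ZMod p) ≠ 0) ∧
      ∑ w ∈ Um, ((∏ j, ((A (w j)).card * (B (w j)).card * (C (w j)).card) : ℕ) : ℝ) ^ τ =
        (∑ u ∈ U, ((∏ j, ((A (u j)).card * (B (u j)).card * (C (u j)).card) : ℕ) : ℝ) ^ τ) ^ m)
    (h4 : ∀ τ : ℝ, 2 / 3 < τ →
      ∃ (p : ℕ) (_ : 2 ≤ p) (Γ : Type) (_ : Fintype Γ) (_ : DecidableEq Γ)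
        (A B C : Γ → Finset (Fin p))
        (_ : ∀ x : Γ, AddTripleProductProperty
          ((A x).image fun d : Fin p => ((d : ℕ) : ZMod p))
          ((B x).image fun d : Fin p => ((d : ℕ) : ZMod p))
          ((C x).image fun d : Fin p => ((d : ℕ) : ZMod p)))
        (k : ℕ) (U : Finset (Fin k → Γ))
        (_ : ∀ u ∈ U, ∀ v ∈ U, ∀ w ∈ U, ¬ (u = v ∧ v = w) → ∃ j : Fin k,
          ∀ s ∈ A (w j), ∀ s' ∈ A (u j), ∀ t ∈ B (u j), ∀ t' ∈ B (v j), ∀ c ∈ C (v j),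
            ∀ c' ∈ C (w j), ∀ e : ℤ, |e| ≤ 2 →
              (((((s' : ℕ) : ℤ) - (s : ℕ)) + (((t' : ℕ) : ℤ) - (t : ℕ)) + (((c' : ℕ) : ℤ) - (c : ℕ))
                + e : ℤ) : ZMod p) ≠ 0),
        (p : ℝ) ^ k <
          ∑ u ∈ U, ((∏ j, ((A (u j)).card * (B (u j)).card * (C (u j)).card) : ℕ) : ℝ) ^ τ) :
    ∀ τ : ℝ, 2 / 3 < τ →
      ∃ (p K n : ℕ) (_ : 2 ≤ p) (A B C : Fin n → Finset (ZMod (p ^ K))),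
        IsSTPP A B C ∧ (p : ℝ) ^ K < ∑ i, (((A i).card * (B i).card * (C i).card : ℕ) : ℝ) ^ τ := by
  classical
  intro τ hτ
  obtain ⟨p, hp, Γ, instF, instD, A, B, C, hT, k, U, hU, hbeat⟩ := h4 τ hτ
  -- the packing sum of the code and its ratio `r > 1`
  set S : ℝ := ∑ u ∈ U, ((∏ j, ((A (u j)).card * (B (u j)).card * (C (u j)).card) : ℕ) : ℝ) ^ τ
    with hS
  have hpk : (0 : ℝ) < (p : ℝ) ^ k := by positivity
  have hr : 1 < S / (p : ℝ) ^ k := by rwa [one_lt_div hpk]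
  obtain ⟨m, hm⟩ := pow_unbounded_of_one_lt (6 : ℝ) hr
  -- the `m`-th concatenation power of the code
  set Um : Finset (Fin (m * k) → Γ) :=
    Finset.univ.filter fun w => ∀ t : Fin m, (fun j : Fin k => w (finProdFinEquiv (t, j))) ∈ U
    with hUm_def
  have hUm : ∀ w, w ∈ Um ↔ ∀ t : Fin m, (fun j : Fin k => w (finProdFinEquiv (t, j))) ∈ U := by
    intro w
    simp [hUm_def]
  obtain ⟨hUmsep, hsum⟩ := h3 p k m Γ A B C U hU Um hUm τ
  have hSTPP := h2 p (m * k) hp Γ A B C hT Um hUmsep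
  -- reindex the family along `Fin n ≃ Um`
  set n : ℕ := Fintype.card Um with hn
  set e : Fin n ≃ Um := (Fintype.equivFin Um).symm with he
  set boxA : Um → Finset (ZMod (p ^ (m * k))) := fun u =>
    (Fintype.piFinset fun j => A (u.1 j)).image
      fun a : Fin (m * k) → Fin p => (digitValue a : ZMod (p ^ (m * k))) with hboxA
  set boxB : Um → Finset (ZMod (p ^ (m * k))) := fun u =>
    (Fintype.piFinset fun j => B (u.1 j)).image
      fun a : Fin (m * k) → Fin p => (digitValue a : ZMod (p ^ (m * k))) with hboxB
  set boxC : Um → Finset (ZMod (p ^ (m * k))) := fun u =>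
    (Fintype.piFinset fun j => C (u.1 j)).image
      fun a : Fin (m * k) → Fin p => (digitValue a : ZMod (p ^ (m * k))) with hboxC
  have hSTPP' : IsSTPP (boxA ∘ e) (boxB ∘ e) (boxC ∘ e) :=
    (isSTPP_iff_addSimultaneousTPP _ _ _).2 (hSTPP.comp e.injective)
  -- cardinalities of the boxes
  have hcard : ∀ (D : Γ → Finset (Fin p)) (u : Um),
      ((Fintype.piFinset fun j => D (u.1 j)).image
        fun a : Fin (m * k) → Fin p => (digitValue a : ZMod (p ^ (m * k)))).card =
        ∏ j, (D (u.1 j)).card := by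
    intro D u
    rw [Finset.card_image_of_injective _ (natCast_digitValue_injective p (m * k)),
      Fintype.card_piFinset]
  have hmass : ∀ u : Um, (boxA u).card * (boxB u).card * (boxC u).card =
      ∏ j, ((A (u.1 j)).card * (B (u.1 j)).card * (C (u.1 j)).card) := by
    intro u
    simp only [hboxA, hboxB, hboxC, hcard, Finset.prod_mul_distrib]
  -- the packing sum of the reindexed design
  have hsum' : ∑ i, ((((boxA ∘ e) i).card * ((boxB ∘ e) i).card * ((boxC ∘ e) i).card : ℕ) : ℝ) ^
      τ = S ^ m := by
    simp only [Function.comp_apply]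
    rw [e.sum_comp (fun u => (((boxA u).card * (boxB u).card * (boxC u).card : ℕ) : ℝ) ^ τ)]
    simp only [hmass]
    rw [Finset.sum_coe_sort Um (fun u => ((∏ j, ((A (u j)).card * (B (u j)).card *
      (C (u j)).card) : ℕ) : ℝ) ^ τ), hsum]
  refine ⟨p, m * k, n, hp, boxA ∘ e, boxB ∘ e, boxC ∘ e, hSTPP', ?_⟩
  rw [hsum']
  have hSm : S ^ m = (S / (p : ℝ) ^ k) ^ m * (p : ℝ) ^ (m * k) := by
    rw [div_pow, mul_comm m k, pow_mul, div_mul_cancel₀]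
    exact pow_ne_zero _ (pow_ne_zero _ (by exact_mod_cast (by omega : p ≠ 0)))
  rw [hSm]
  have hpmk : (0 : ℝ) < (p : ℝ) ^ (m * k) := by positivity
  nlinarith

/-- **Composition.** Stubs 1, 5, 6 imply the crux `AutomaticPackingThesis` (with base `2`): given
`ε > 0` put `τ = (2+ε)/3`; a finite witness (stub 6) in `ℤ/p^K` with ratio
`r = Σ_i x_i^τ / p^K > 1` has concatenation powers (stub 5, `concatPower`) in `ℤ/p^(Km)` with
ratio `r^m > 6`, i.e. finite cyclic STPP designs with `Σ x^τ > 3·2·N`, `N = p^(Km)`;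
`BlockTensorTransfer` (stub 1) turns one into a regular all-scales family in the `ℤ/2^k` tower
beating `2^k` at exponent `τ` infinitely often. -/
theorem AutomaticPackingThesis_of
    (h1 : BlockTensorTransfer)
    (h5 : ∀ (p K K' : ℕ), 0 < p → ∀ (ι ι' : Type)
      (A B C : ι → Finset (ZMod (p ^ K))) (A' B' C' : ι' → Finset (ZMod (p ^ K'))),
      AddSimultaneousTPP A B C → AddSimultaneousTPP A' B' C' →
      AddSimultaneousTPP
        (fun i : ι × ι' => (A i.1 ×ˢ A' i.2).image
          fun x => ((x.1.val + p ^ K * x.2.val : ℕ) : ZMod (p ^ (K + K'))))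
        (fun i : ι × ι' => (B i.1 ×ˢ B' i.2).image
          fun x => ((x.1.val + p ^ K * x.2.val : ℕ) : ZMod (p ^ (K + K'))))
        (fun i : ι × ι' => (C i.1 ×ˢ C' i.2).image
          fun x => ((x.1.val + p ^ K * x.2.val : ℕ) : ZMod (p ^ (K + K')))))
    (h6 : ∀ τ : ℝ, 2 / 3 < τ →
      ∃ (p K n : ℕ) (_ : 2 ≤ p) (A B C : Fin n → Finset (ZMod (p ^ K))),
        IsSTPP A B C ∧ (p : ℝ) ^ K < ∑ i, (((A i).card * (B i).card * (C i).card : ℕ) : ℝ) ^ τ) :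
    AutomaticPackingThesis := by
  classical
  refine ⟨2, le_rfl, fun ε hε => ?_⟩
  have hτ : (2 : ℝ) / 3 < (2 + ε) / 3 := by linarith
  have hτ0 : (0 : ℝ) < (2 + ε) / 3 := by linarith
  obtain ⟨p, K, n, hp, A, B, C, hS, hbeat⟩ := h6 ((2 + ε) / 3) hτ
  set S : ℝ := ∑ i, (((A i).card * (B i).card * (C i).card : ℕ) : ℝ) ^ ((2 + ε) / 3) with hSdef
  have hpK : (0 : ℝ) < (p : ℝ) ^ K := by positivity
  have hr : 1 < S / (p : ℝ) ^ K := by rwa [one_lt_div hpK]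
  obtain ⟨m, hm⟩ := pow_unbounded_of_one_lt (6 : ℝ) hr
  obtain ⟨nm, Am, Bm, Cm, hSm, hsum⟩ :=
    concatPower h5 p K (by omega) n A B C hS ((2 + ε) / 3) m
  have h1N : 1 ≤ p ^ (K * m) := Nat.one_le_pow _ _ (by omega)
  have hbig : (3 * (2 : ℕ) * (p ^ (K * m) : ℕ) : ℝ) <
      ∑ i, (((Am i).card * (Bm i).card * (Cm i).card : ℕ) : ℝ) ^ ((2 + ε) / 3) := by
    rw [hsum]
    have hSm' : S ^ m = (S / (p : ℝ) ^ K) ^ m * (p : ℝ) ^ (K * m) := by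
      rw [div_pow, pow_mul, div_mul_cancel₀]
      exact pow_ne_zero _ (pow_ne_zero _ (by exact_mod_cast (by omega : p ≠ 0)))
    rw [hSm']
    have hpKm : (0 : ℝ) < (p : ℝ) ^ (K * m) := by positivity
    push_cast
    nlinarith
  obtain ⟨ι, instι, LA, LB, LC, hA, hB, hC, hfam⟩ :=
    h1 (p ^ (K * m)) nm Am Bm Cm h1N hSm 2 le_rfl ((2 + ε) / 3) hτ0 hbig
  exact ⟨ι, instι, LA, LB, LC, hA, hB, hC, hfam⟩

/-- **Stub 6 is a normal form of the crux** (converse of the composition, real proof): a level `k`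
of a witnessing tower at `ε = 3τ - 2` is a finite STPP design in `ℤ/p^k` beating its host at
exponent `τ`. So `stub_cyclicBeat` ⟺ `AutomaticPackingThesis` given stubs 1 and 5 (both proved);
it is registered as a stub because it is the finite, base-free, `ε`-by-`ε` form that every
construction feeds, not because it is easier. -/
theorem cyclicBeat_of_crux (h : AutomaticPackingThesis) :
    ∀ τ : ℝ, 2 / 3 < τ →
      ∃ (p K n : ℕ) (_ : 2 ≤ p) (A B C : Fin n → Finset (ZMod (p ^ K))),
        IsSTPP A B C ∧ (p : ℝ) ^ K < ∑ i, (((A i).card * (B i).card * (C i).card : ℕ) : ℝ) ^ τ := by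
  classical
  intro τ hτ
  obtain ⟨p, hp, h⟩ := h
  obtain ⟨ι, _, LA, LB, LC, -, -, -, hS, hbeat⟩ := h (3 * τ - 2) (by linarith)
  obtain ⟨k, -, hk⟩ := hbeat 0
  have hexp : (2 + (3 * τ - 2)) / 3 = τ := by ring
  rw [hexp] at hk
  -- the level-`k` family, reindexed along `Fin n ≃ (Fin k → ι)`
  set e : Fin (Fintype.card (Fin k → ι)) ≃ (Fin k → ι) := (Fintype.equivFin (Fin k → ι)).symm
    with he
  refine ⟨p, k, Fintype.card (Fin k → ι), hp, _, _, _,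
    (isSTPP_iff_addSimultaneousTPP _ _ _).2 ((hS k).comp e.injective), ?_⟩
  exact hk.trans_eq (e.sum_comp (fun w => (((automaticBlock p k LA w).card *
    (automaticBlock p k LB w).card * (automaticBlock p k LC w).card : ℕ) : ℝ) ^ τ)).symm

/-! ### Reshape (cycle 3, lead c2): the UNIFORM normal form

The crux is equivalent to its normal form restricted to UNIFORM designs — every block of every
triple has the same size `M ≥ 2` — so that a witness at exponent `τ` is exactly a packing of
`n` uniform TPP triples with efficiency `η = n M² / p^K > M^(2-3τ)`. Reduction: tensor (concatenation)
powers of a beating design, grouped by word type (at most `(m+1)^n` size profiles against a ratio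
`r^m`), give a beating sub-design with ONE size profile `(a, b, c)`; concatenating its three role
rotations `(A,B,C)`, `(B,C,A)`, `(C,A,B)` makes every block size `abc`. Stubs 7–10 are the
worker-sized pieces; stub 11 is the equivalence (lead). -/

/-- Stub 7 (explicit concatenation powers with product block sizes): an STPP design in `ℤ/p^K`
indexed by `Fin n` has, for every `m`, an `m`-th concatenation power indexed by WORDS
`w : Fin m → Fin n`, an STPP family in `ℤ/p^(K m)` whose blocks have the product sizes
`|A_w| = Π_t |A (w t)|` (and likewise for `B`, `C`). (Induction on `m` with stub 5 and
`Fin.consEquiv`/`Fin.snocEquiv`; `K * (m+1) = K * m + K` definitionally.) [folklore] -/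
theorem stub_powFamily (p K n : ℕ) (hp : 0 < p) (A B C : Fin n → Finset (ZMod (p ^ K)))
    (hS : IsSTPP A B C) (m : ℕ) :
    ∃ (Am Bm Cm : (Fin m → Fin n) → Finset (ZMod (p ^ (K * m)))),
      AddSimultaneousTPP Am Bm Cm ∧
      ∀ w, (Am w).card = ∏ t, (A (w t)).card ∧ (Bm w).card = ∏ t, (B (w t)).card ∧
        (Cm w).card = ∏ t, (C (w t)).card :=
  -- CLOSED: landed as `--supports` (p123897), Theorems/AutomaticSTPPDesignsAutomaticPackingThesisStubPowFamily.lean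
  Summit.MatrixMultiplication.MatrixMultiplication.Theorems.AutomaticPackingThesis.stub_powFamily
    p K n hp A B C hS m

/-- Stub 8 (few size profiles): over all words `w : Fin m → Fin n`, the size profile
`(Π_t a (w t), Π_t b (w t), Π_t c (w t))` takes at most `(m+1)^n` values (it factors through the
word type `i ↦ #{t : w t = i} ∈ {0,…,m}`; tree: `wordType`, `prod_eq_prod_pow_wordType`).
[cite: BlasiakChurchCohnGrochowNaslundSawinUmans2017, Lemma 3.5 (proof)] -/
theorem stub_typeCount (n m : ℕ) (a b c : Fin n → ℕ) :
    (Finset.univ.image fun w : Fin m → Fin n =>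
      (∏ t, a (w t), ∏ t, b (w t), ∏ t, c (w t))).card ≤ (m + 1) ^ n :=
  -- CLOSED: landed as `--supports` (p123981), Theorems/AutomaticSTPPDesignsAutomaticPackingThesisStubTypeCount.lean
  Summit.MatrixMultiplication.MatrixMultiplication.Theorems.AutomaticPackingThesis.stub_typeCount n m a b c

/-- Stub 9 (exponential beats polynomial): for `r > 1`, `n : ℕ` and any constant `c`, some power
`r^m` exceeds `c (m+1)^n` (Mathlib: `tendsto_pow_const_div_const_pow_of_one_lt`). [folklore] -/
theorem stub_expBeatsPoly (r : ℝ) (hr : 1 < r) (n : ℕ) (c : ℝ) :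
    ∃ m : ℕ, c * ((m : ℝ) + 1) ^ n < r ^ m :=
  -- CLOSED: landed as `--supports` (p124059), Theorems/AutomaticSTPPDesignsAutomaticPackingThesisStubExpBeatsPoly.lean
  Summit.MatrixMultiplication.MatrixMultiplication.Theorems.AutomaticPackingThesis.stub_expBeatsPoly r hr n c

/-- Stub 10 (three-fold concatenation with product block sizes): three STPP designs in `ℤ/p^K₁`,
`ℤ/p^K₂`, `ℤ/p^K₃` (indexed by `Fin n₁`, `Fin n₂`, `Fin n₃`) concatenate into one STPP family in
`ℤ/p^(K₁+K₂+K₃)` indexed by `Fin n₁ × Fin n₂ × Fin n₃` whose block sizes are the products of the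
corresponding block sizes (stub 5 twice, `card_concat`, reindexing along `Equiv.prodAssoc`).
[folklore] -/
theorem stub_tripleConcat (p K₁ K₂ K₃ n₁ n₂ n₃ : ℕ) (hp : 0 < p)
    (A₁ B₁ C₁ : Fin n₁ → Finset (ZMod (p ^ K₁))) (A₂ B₂ C₂ : Fin n₂ → Finset (ZMod (p ^ K₂)))
    (A₃ B₃ C₃ : Fin n₃ → Finset (ZMod (p ^ K₃)))
    (h₁ : IsSTPP A₁ B₁ C₁) (h₂ : IsSTPP A₂ B₂ C₂) (h₃ : IsSTPP A₃ B₃ C₃) :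
    ∃ (A B C : Fin n₁ × Fin n₂ × Fin n₃ → Finset (ZMod (p ^ (K₁ + K₂ + K₃)))),
      AddSimultaneousTPP A B C ∧
      ∀ i, (A i).card = (A₁ i.1).card * (A₂ i.2.1).card * (A₃ i.2.2).card ∧
        (B i).card = (B₁ i.1).card * (B₂ i.2.1).card * (B₃ i.2.2).card ∧
        (C i).card = (C₁ i.1).card * (C₂ i.2.1).card * (C₃ i.2.2).card :=
  -- CLOSED: landed as `--supports` (p124065), Theorems/AutomaticSTPPDesignsAutomaticPackingThesisStubTripleConcat.lean
  Summit.MatrixMultiplication.MatrixMultiplication.Theorems.AutomaticPackingThesis.stub_tripleConcat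
    p K₁ K₂ K₃ n₁ n₂ n₃ hp A₁ B₁ C₁ A₂ B₂ C₂ A₃ B₃ C₃ h₁ h₂ h₃

/-- Stub 11 (THE UNIFORM NORMAL FORM, lead): `AutomaticPackingThesis` holds iff for every
`τ > 2/3` some STPP design in some `ℤ/p^K` (`p ≥ 2`) all of whose blocks have the same size
`M ≥ 2` beats its host: `p^K < n · (M³)^τ`, i.e. packs `n` uniform TPP triples with efficiency
`n M² / p^K > M^(2-3τ)`. (`→`: stub 6's converse + stubs 7–10 + role rotation; `←`: a uniform
witness is a witness.) [folklore] -/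
theorem stub_uniformNormalForm :
    AutomaticPackingThesis ↔
      ∀ τ : ℝ, 2 / 3 < τ → ∃ (p K n M : ℕ) (_ : 2 ≤ p) (_ : 2 ≤ M)
        (A B C : Fin n → Finset (ZMod (p ^ K))),
        IsSTPP A B C ∧ (∀ i, (A i).card = M ∧ (B i).card = M ∧ (C i).card = M) ∧
          (p : ℝ) ^ K < n * ((M : ℝ) ^ 3) ^ τ :=
  -- CLOSED (lead c2): landed as `--supports` (p124204), Theorems/AutomaticSTPPDesignsAutomaticPackingThesisUniformNormalForm.lean
  Summit.MatrixMultiplication.MatrixMultiplication.Theorems.AutomaticPackingThesis.stub_uniformNormalForm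

/-- Stub 12 (witness size, lead): what the tree's packing inequalities force on a UNIFORM witness
at an exponent `τ ≤ 1`: `n ≥ 2`, the tiling bound `M³ ≤ p^K`, the two-term bound
`(2n-1)M² ≤ p^K`, hence `M^(3τ-2) > 3/2` (so `M > (3/2)^(1/(3τ-2)) → ∞` as `τ ↓ 2/3`:
InfimumNotMinimum quantified) and `n > M^(3-3τ)`. [folklore] -/
theorem stub_uniformWitnessSize (p K n M : ℕ) (hp : 0 < p) (A B C : Fin n → Finset (ZMod (p ^ K)))
    (hS : IsSTPP A B C) (hcard : ∀ i, (A i).card = M ∧ (B i).card = M ∧ (C i).card = M)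
    (hM : 2 ≤ M) {τ : ℝ} (hτ1 : τ ≤ 1)
    (hbeat : (p : ℝ) ^ K < n * ((M : ℝ) ^ 3) ^ τ) :
    2 ≤ n ∧ M ^ 3 ≤ p ^ K ∧ (2 * n - 1) * M ^ 2 ≤ p ^ K ∧
      (3 / 2 : ℝ) < (M : ℝ) ^ (3 * τ - 2) ∧ (M : ℝ) ^ (3 - 3 * τ) < n :=
  -- CLOSED (lead c2): landed as `--supports` (p124334), Theorems/AutomaticSTPPDesignsAutomaticPackingThesisUniformWitnessSize.lean
  Summit.MatrixMultiplication.MatrixMultiplication.Theorems.AutomaticPackingThesis.stub_uniformWitnessSize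
    p K n M hp A B C hS hcard hM hτ1 hbeat

/-- Stub 13 (calibration rung 0.94, lead): stub 6's statement holds for every `τ ≥ 47/50` — the
CKSU two-triple design over the coprime moduli `15, 16, 17` in the cyclic group `ℤ/4080`
(masses `3360` twice; exact threshold `≈ 0.93855`, optimal among two-triple CRT designs).
[cite: CohnKleinbergSzegedyUmans2005, §5] -/
theorem stub_cyclicBeat_of_ge094 : ∀ τ : ℝ, (47 : ℝ) / 50 ≤ τ →
    ∃ (p K n : ℕ) (_ : 2 ≤ p) (A B C : Fin n → Finset (ZMod (p ^ K))),
      Literature.Computability.AlgebraicComplexity.IsSTPP A B C ∧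
        (p : ℝ) ^ K < ∑ i, (((A i).card * (B i).card * (C i).card : ℕ) : ℝ) ^ τ :=
  -- CLOSED (lead c2): landed as `--supports` (p124552), Theorems/AutomaticSTPPDesignsAutomaticPackingThesisCyclicCalibration094.lean
  Summit.MatrixMultiplication.MatrixMultiplication.Theorems.AutomaticPackingThesis.stub_cyclicBeat_of_ge094

/-- Stub 14 (THE PRIME-UNIFORM NORMAL FORM, lead): `AutomaticPackingThesis` holds iff for every
`τ > 2/3` some PRIME cyclic group `ℤ/q` hosts an STPP design all of whose blocks have one size
`M ≥ 2` with `q < n · (M³)^τ` (uniform normal form + uniform powers + re-hosting along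
representatives into `ℤ/q`, `q ∈ (3N, 6N]` prime by Bertrand). [folklore] -/
theorem stub_primeUniformNormalForm :
    AutomaticPackingThesis ↔
      ∀ τ : ℝ, 2 / 3 < τ → ∃ (q n M : ℕ) (_ : q.Prime) (_ : 2 ≤ M)
        (A B C : Fin n → Finset (ZMod q)),
        IsSTPP A B C ∧ (∀ i, (A i).card = M ∧ (B i).card = M ∧ (C i).card = M) ∧
          (q : ℝ) < n * ((M : ℝ) ^ 3) ^ τ :=
  -- CLOSED (lead c2): landed as `--supports` (p124711), Theorems/AutomaticSTPPDesignsAutomaticPackingThesisPrimeUniform.lean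
  Summit.MatrixMultiplication.MatrixMultiplication.Theorems.AutomaticPackingThesis.stub_primeUniformNormalForm

/-! ### Reshape (cycle 4, lead c3): one open stub; calibration rung 0.80 from crux #2

Since 2026-08-16T22:11Z the route's crux #2 `AutomaticDesignBelowFourFifths` is PROVED in the tree
(`Theorems.AutomaticDesignBelowFourFifths_proof`: Coppersmith–Winograd's level-1 laser design for
`CW₆` run inside ONE cyclic group `ℤ/8^(3a+3b)` by digit-sum slicing + Kummer). One level of that
tower is a finite cyclic design beating its host at exponent `4/5` (`cyclicDesign_of_crux`), so the
open stub's statement holds at every `τ ≥ 4/5` (stub 15): the theorem-level calibration of the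
line drops from `47/50` to `4/5`, and a refutation in normal form
(`not_automaticPackingThesis_iff_uniformGap`) needs a ceiling exponent `τ₀ < 4/5`. The mechanism
stub `stub_chartCapacity` leaves the registry (see the header). -/

/-- Stub 15 (calibration rung 0.80, lead c3): stub 6's statement holds for every `τ ≥ 4/5` — one
beating level of the sliced Coppersmith–Winograd tower of `AutomaticDesignBelowFourFifths_proof`,
read as a finite design in `ℤ/N` (`K = 1`), with `N < Σ x^(4/5) ≤ Σ x^τ`.
[cite: CoppersmithWinograd1990, §7] -/
theorem stub_cyclicBeat_of_ge080 : ∀ τ : ℝ, (4 : ℝ) / 5 ≤ τ →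
    ∃ (p K n : ℕ) (_ : 2 ≤ p) (A B C : Fin n → Finset (ZMod (p ^ K))),
      Literature.Computability.AlgebraicComplexity.IsSTPP A B C ∧
        (p : ℝ) ^ K < ∑ i, (((A i).card * (B i).card * (C i).card : ℕ) : ℝ) ^ τ :=
  -- CLOSED (lead c3): landed as `--supports` (p144676), Theorems/AutomaticSTPPDesignsAutomaticPackingThesisCyclicCalibration080.lean
  Summit.MatrixMultiplication.MatrixMultiplication.Theorems.AutomaticPackingThesis.stub_cyclicBeat_of_ge080

/-! ### Reshape (cycle 4, lead c3), continued: the crux between two named open problems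

Logical geography of the open stub, as registered worker-sized stubs (all three are honest
theorems, no conjecture assumed): the crux IMPLIES the abelian STPP thesis `CThesis` of route
`GroupTheoreticSTPP` (stmt-0593, "X_C"); the crux is EQUIVALENT to the existence of STPP designs
in homocyclic groups `(ℤ/N)^R` of any rank beating `3^R · N^R` (mixed-radix transfer, the
`3^rank` being the exact price of cyclicity); and the crux FOLLOWS from CKSU 2005 Conj. 4.7 (two
families with the simultaneous double product property, in ARBITRARY finite abelian hosts) =
route item `CPackingConstruction` (stmt-0595), by the argument of Pratt 2024 Thm. 4.7 (Behrend
corner-free index set, CKSU's SDPP → STPP lift to `H³`, the bounded-order part of `H` is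
`n^{O(δ)}` by BCCGNSU 2017 slice rank, mixed-radix transfer `H³ ↪ ℤ/N`), all of whose inputs are
proved in the tree. So `CPackingConstruction → AutomaticPackingThesis → CThesis`, and the route's
negative `CAbelianObstructionNeg` (stmt-0596) refutes the crux. -/

/-- Stub 16 (lead c3; the crux implies X_C): a witness of `AutomaticPackingThesis` at `ε` is, at a
beating scale, a finite STPP family in the finite abelian group `ℤ/(p^k)` beating its order at
exponent `(2+ε)/3` — a witness of `CThesis` (route `GroupTheoreticSTPP`, stmt-0593) at `ε`
(`cyclicBeat_of_automaticPackingThesis`; `IsSTPP` unfolds to the predicate inlined in `CThesis`,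
`isSTPP_iff`). [folklore] -/
theorem stub_cruxGivesCThesis :
    AutomaticPackingThesis →
      Summit.MatrixMultiplication.MatrixMultiplication.Theses.GroupTheoreticSTPP.CThesis :=
  -- CLOSED (worker, cycle 4): landed as `--supports` (p145807), Theorems/AutomaticSTPPDesignsAutomaticPackingThesisCruxGivesCThesis.lean
  Summit.MatrixMultiplication.MatrixMultiplication.Theorems.AutomaticPackingThesis.stub_cruxGivesCThesis

/-- Stub 17 (lead c3; THE RANK NORMAL FORM): `AutomaticPackingThesis` holds iff for every
`τ > 2/3` some STPP design in some homocyclic group `(ℤ/N)^R` (`N, R ≥ 1`) beats `3^R · N^R` at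
exponent `τ`. (`→`: the any-modulus normal form with the ratio pumped above `3` by concatenation
powers, read in rank `R = 1` along `x ↦ (fun _ => x)`; `←`: the mixed-radix map
`x ↦ Σ_j x_j (3N)^j` reflects three-fold sums (`exists_freiman3_pi_zmod`), so the image family in
`ℤ/(3^R N^R)` is STPP with the same block sizes (`addSimultaneousTPP_image_of_reflect`), and the
any-modulus normal form applies.) [cite: Pratt2024, Thm. 4.7 (proof)] -/
theorem stub_rankBeatNormalForm :
    AutomaticPackingThesis ↔
      ∀ τ : ℝ, 2 / 3 < τ → ∃ (N R n : ℕ) (_ : 1 ≤ N) (_ : 1 ≤ R)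
        (A B C : Fin n → Finset (Fin R → ZMod N)),
        IsSTPP A B C ∧
          (3 : ℝ) ^ R * (N : ℝ) ^ R < ∑ i, (((A i).card * (B i).card * (C i).card : ℕ) : ℝ) ^ τ :=
  -- CLOSED (worker, cycle 4): landed as `--supports` (p147180), Theorems/AutomaticSTPPDesignsAutomaticPackingThesisRankNormalForm.lean
  Summit.MatrixMultiplication.MatrixMultiplication.Theorems.AutomaticPackingThesis.stub_rankBeatNormalForm

/-- Stub 18 (lead c3; TWO FAMILIES GIVE THE CRUX): CKSU 2005 Conjecture 4.7 — route item
`CPackingConstruction` of `GroupTheoreticSTPP` (stmt-0595): for every `δ > 0` and arbitrarily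
large `n`, some finite abelian `H` with `|H| ≤ n^(2+δ)` holds `n` SDPP pairs `(Aᵢ, Bᵢ)` with
`|Aᵢ||Bᵢ| ≥ n^(2-δ)` — implies `AutomaticPackingThesis`. Proof = Pratt 2024 Thm. 4.7's proof
(tree: `pratt2024_thm47_aux`, every input proved) with the endgame changed: for `τ = 2/3 + γ` run it
with Pratt's `ε := min γ 1`; the transferred STPP family in `ℤ/N`, `N = (3^k |H|)^3`,
`log N ≤ (6 + 3δ + 3ε/2) log n + O(1)`, has `|ι₀| ≥ n^(2-δ)/64·(1/4)` blocks of mass `≥ n^(3(2-δ))`,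
so `log Σ x^τ ≥ (6 + 6γ - 3δ - 3γδ) log n - O(1) > log N` for `n` large (`δ ≤ ε/8`); conclude by
`automaticPackingThesis_iff_anyModulus`. [cite: Pratt2024, Thm. 4.7 (proof)]
[cite: CohnKleinbergSzegedyUmans2005, Conj. 4.7] -/
theorem stub_twoFamiliesBridge :
    Summit.MatrixMultiplication.MatrixMultiplication.Theses.GroupTheoreticSTPP.CPackingConstruction →
      AutomaticPackingThesis :=
  -- CLOSED (worker, cycle 4): landed as `--supports` (p148800), Theorems/AutomaticSTPPDesignsAutomaticPackingThesisTwoFamiliesBridge.lean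
  Summit.MatrixMultiplication.MatrixMultiplication.Theorems.AutomaticPackingThesis.stub_twoFamiliesBridge

/-- The crux sits between the two named open problems of route `GroupTheoreticSTPP`:
`CPackingConstruction → AutomaticPackingThesis → CThesis` (stubs 18, 16). -/
theorem crux_between :
    (Summit.MatrixMultiplication.MatrixMultiplication.Theses.GroupTheoreticSTPP.CPackingConstruction →
      AutomaticPackingThesis) ∧
    (AutomaticPackingThesis →
      Summit.MatrixMultiplication.MatrixMultiplication.Theses.GroupTheoreticSTPP.CThesis) :=
  ⟨stub_twoFamiliesBridge, stub_cruxGivesCThesis⟩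

/-- Calibration in one statement: the open stub restricted to `τ ≥ 4/5` is a theorem (stub 15),
so only the window `2/3 < τ < 4/5` of `stub_cyclicBeat` is open. [folklore] -/
theorem cyclicBeat_window (h : ∀ τ : ℝ, 2 / 3 < τ → τ < 4 / 5 →
      ∃ (p K n : ℕ) (_ : 2 ≤ p) (A B C : Fin n → Finset (ZMod (p ^ K))),
        IsSTPP A B C ∧ (p : ℝ) ^ K < ∑ i, (((A i).card * (B i).card * (C i).card : ℕ) : ℝ) ^ τ) :
    ∀ τ : ℝ, 2 / 3 < τ →
      ∃ (p K n : ℕ) (_ : 2 ≤ p) (A B C : Fin n → Finset (ZMod (p ^ K))),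
        IsSTPP A B C ∧ (p : ℝ) ^ K < ∑ i, (((A i).card * (B i).card * (C i).card : ℕ) : ℝ) ^ τ := by
  intro τ hτ
  by_cases hlt : τ < 4 / 5
  · exact h τ hτ hlt
  · exact stub_cyclicBeat_of_ge080 τ (not_lt.1 hlt)

/-- The line closes the crux modulo its ONE open stub (kernel check of the composition's shape):
stubs 1, 5, 6 (`stub_blockTensorTransfer`, `stub_concatSTPP` closed; `stub_cyclicBeat` open). -/
theorem AutomaticPackingThesis_lineSketch : AutomaticPackingThesis :=
  AutomaticPackingThesis_of stub_blockTensorTransfer stub_concatSTPP stub_cyclicBeat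

/-- The same closure from the open WINDOW alone: designs for `2/3 < τ < 4/5` suffice (stub 15
covers `τ ≥ 4/5`). -/
theorem AutomaticPackingThesis_of_window (h : ∀ τ : ℝ, 2 / 3 < τ → τ < 4 / 5 →
      ∃ (p K n : ℕ) (_ : 2 ≤ p) (A B C : Fin n → Finset (ZMod (p ^ K))),
        IsSTPP A B C ∧ (p : ℝ) ^ K < ∑ i, (((A i).card * (B i).card * (C i).card : ℕ) : ℝ) ^ τ) :
    AutomaticPackingThesis :=
  AutomaticPackingThesis_of stub_blockTensorTransfer stub_concatSTPP (cyclicBeat_window h)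

/-! ### Cycle 5 (lead c4): the open window priced in `ω`

Every single witness of the open stub is itself a theorem about the exponent of matrix
multiplication: by CKSU 2005 Thm. 5.5 (abelian case, tree theorem
`CohnKleinbergSzegedyUmans2005_5_5_abelian_holds`) a finite STPP design in `ℤ/p^K` beating its
host at exponent `τ` forces `ω(ℂ) < 3τ` (stub 19). So the open window `2/3 < τ < 4/5` is graded:
a witness at `τ ≤ 0.7904` would improve the best known bound `ω < 2.3714`; witnesses at
`0.7904 < τ < 0.8` amount to re-hosting the higher levels of the laser method in one cyclic group
(CKSU 2005 §7 assert `ω < 2.376`, i.e. `τ = 0.792`, from their chart theorem with a 24-symbol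
chart; BCCGNSU 2017 p. 3 assert that the bounds of CW/DS/W/Le Gall yield STPP constructions in
`(ℤ/m)^n`), which moves the rung but not the crux; and witnesses for all `τ > 2/3` are `ω = 2`
(`omega_eq_two_of_cyclicBeat`, the stub-level form of the route assembly). -/

/-- Stub 19 (lead c4; PRICING of the open stub, CKSU 2005 Thm. 5.5 at one exponent): a finite STPP
design in a cyclic group `ℤ/p^K` (`p ≥ 2`) with `p^K < Σᵢ (|Aᵢ||Bᵢ||Cᵢ|)^τ`, `τ > 0`, proves
`ω(ℂ) < 3τ` (if `3τ ≤ ω` then `Σ xᵢ^τ ≤ Σ xᵢ^{ω/3} ≤ p^K`, as every `xᵢ` is `0` or `≥ 1`).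
[cite: CohnKleinbergSzegedyUmans2005, Thm. 5.5] -/
theorem stub_beatPricesOmega (τ : ℝ) (hτ : 0 < τ) (p K n : ℕ) (hp : 2 ≤ p)
    (A B C : Fin n → Finset (ZMod (p ^ K))) (hS : IsSTPP A B C)
    (hbeat : (p : ℝ) ^ K < ∑ i, (((A i).card * (B i).card * (C i).card : ℕ) : ℝ) ^ τ) :
    omega ℂ < 3 * τ :=
  -- CLOSED (lead c4): landed as `--supports` (p151449), Theorems/AutomaticSTPPDesignsAutomaticPackingThesisStubPricing.lean
  Summit.MatrixMultiplication.MatrixMultiplication.Theorems.AutomaticPackingThesis.stub_beatPricesOmega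
    τ hτ p K n hp A B C hS hbeat

/-- A witness of the open stub `stub_cyclicBeat` at ONE exponent `τ > 2/3` is an unconditional
proof of `ω(ℂ) < 3τ` (stub 19): e.g. any design in the open window at `τ ≤ 0.79` proves
`ω(ℂ) < 2.37`. [cite: CohnKleinbergSzegedyUmans2005, Thm. 5.5] -/
theorem cyclicBeatAt_prices_omega (τ : ℝ) (hτ : 2 / 3 < τ)
    (h : ∃ (p K n : ℕ) (_ : 2 ≤ p) (A B C : Fin n → Finset (ZMod (p ^ K))),
      IsSTPP A B C ∧ (p : ℝ) ^ K < ∑ i, (((A i).card * (B i).card * (C i).card : ℕ) : ℝ) ^ τ) :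
    omega ℂ < 3 * τ := by
  obtain ⟨p, K, n, hp, A, B, C, hS, hbeat⟩ := h
  exact stub_beatPricesOmega τ (by linarith) p K n hp A B C hS hbeat

/-- The stub-level form of the route assembly, without automata: the open stub's statement
(`stub_cyclicBeat`: witnesses for every `τ > 2/3`) gives `ω(ℂ) = 2` — for `ε > 0` the witness at
`τ = (2 + ε)/3` gives `ω < 2 + ε` (stub 19), and `ω ≥ 2` is `omega_two_le`.
[cite: CohnKleinbergSzegedyUmans2005, Thm. 5.5] -/
theorem omega_eq_two_of_cyclicBeat
    (h : ∀ τ : ℝ, 2 / 3 < τ →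
      ∃ (p K n : ℕ) (_ : 2 ≤ p) (A B C : Fin n → Finset (ZMod (p ^ K))),
        IsSTPP A B C ∧ (p : ℝ) ^ K < ∑ i, (((A i).card * (B i).card * (C i).card : ℕ) : ℝ) ^ τ) :
    omega ℂ = 2 := by
  refine le_antisymm (le_of_forall_pos_lt_add fun ε hε => ?_) (omega_two_le ℂ)
  have hlt := cyclicBeatAt_prices_omega ((2 + ε) / 3) (by linarith) (h ((2 + ε) / 3) (by linarith))
  linarith

/-- Hence the line's one open stub proves the summit statement directly (kernel check of the
pricing composition; open modulo `stub_cyclicBeat`). -/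
theorem matrixMultiplication_of_lineSketch : _root_.MatrixMultiplication :=
  (_root_.MatrixMultiplication_iff).2 (omega_eq_two_of_cyclicBeat stub_cyclicBeat)

end Summit.MatrixMultiplication.MatrixMultiplication.Cruxes.AutomaticPackingThesis.Sketch
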